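import Literature.Algebra.Homology.OrderedCechSystemAlternating
import Literature.Algebra.Homology.OrderedCechSystemCup
import HarnessLib

/-!
# The ordered Čech cup product commutes with refinement along a MONOTONE map of index sets — on cochains
# (Godement II §6.6; Stacks 01FG/01FP)

For a MONOTONE map of index sets `τ : ι' → ι` (e.g. the identity of the index set with a cover refinement `W'_i ⊆ U_i`,
a strictly increasing re-indexing, or the first projection of a lex product), the refinement of ordered Čech cochains
`refineCochain τ φ` of `Algebra/Homology/OrderedCechSystemAlternating` (on a sorted simplex `s'`: the value on
`τ(s')` pushed along `φ_{s'} : M(τ s') → M'(s')`, and `0` when `τ` is not injective on `s'`) is MULTIPLICATIVE ON COCHAINS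
for the front-face/back-face cup product `cup` of `Algebra/Homology/OrderedCechSystemCup`:

* **`refineCochain_cup`** — for pairings `β : M × N → P` on `ι` and `β' : M' × N' → P'` on `ι'` intertwined by the
  refinement data (`φ_P (β(x, y)) = β'(φ_M x, φ_N y)`):
  `refine (f ∪_β g) = refine f ∪_{β'} refine g` (all degrees, no naturality needed).

Proof: monotone maps carry the cuts `s'_{≤v'}`, `s'_{≥v'}` of a simplex on which `τ` is injective onto the cuts of
`τ(s')` (`image_filter_le_of_monotone_injOn`); when `τ` is NOT injective on `s'`, a colliding pair `a < b` straddles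
every cut vertex, so one of the two factors vanishes term by term (`not_injOn_cuts_of_not_injOn`).  For NON-monotone
`τ` the statement fails on cochains (it holds on cohomology only through the full complex — `Algebra/Homology/
OrderedCechFullToOrdered`); it is not asserted here.  THEOREMS ONLY; no named facts.  Library only (cell
hodgecm-mathlib, FLOOR-0 P1 F-11 road A, jobs J3/J4-(iv): the diagonal refinement `Δ^♯` and the slices of the Δ-trick
are monotone); HC_CM is proved only modulo the 7 printed citations until rung 0 closes, and nothing here bears on it.

## References

* [Godement1958] R. Godement, *Topologie algébrique et théorie des faisceaux* (1958), II §6.6 (naturality of the cup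
  product under refinement).
* [StacksProject] The Stacks Project, Tags 01FG (alternating Čech complex and refinements), 01FP (cup product).
-/

universe v u

open CategoryTheory

set_option backward.isDefEq.respectTransparency false

noncomputable section

namespace Literature.Algebra.Homology

namespace OrderedCech

variable {ι ι' : Type} [LinearOrder ι] [LinearOrder ι']

/-! ### Monotone maps and cuts -/

section MonotoneCuts

variable {τ : ι' → ι}

/-- A monotone map injective on `s'` carries the lower cut at `v' ∈ s'` onto the lower cut of the image at `τ v'`.
[cite: StacksProject, Tag 01FG] -/
theorem image_filter_le_of_monotone_injOn (hτ : Monotone τ) {s' : Finset ι'} (hinj : Set.InjOn τ ↑s') {v' : ι'}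
    (hv' : v' ∈ s') : (s'.filter (· ≤ v')).image τ = (s'.image τ).filter (· ≤ τ v') := by
  ext b
  simp only [Finset.mem_image, Finset.mem_filter]
  constructor
  · rintro ⟨a, ⟨ha, hav⟩, rfl⟩
    exact ⟨⟨a, ha, rfl⟩, hτ hav⟩
  · rintro ⟨⟨a, ha, rfl⟩, hle⟩
    refine ⟨a, ⟨ha, ?_⟩, rfl⟩
    by_contra hlt
    have hva : τ v' ≤ τ a := hτ (le_of_lt (not_le.1 hlt))
    have : τ a = τ v' := le_antisymm hle hva
    exact (not_le.1 hlt).ne' (hinj ha hv' this)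

/-- A monotone map injective on `s'` carries the upper cut at `v' ∈ s'` onto the upper cut of the image at `τ v'`.
[cite: StacksProject, Tag 01FG] -/
theorem image_filter_ge_of_monotone_injOn (hτ : Monotone τ) {s' : Finset ι'} (hinj : Set.InjOn τ ↑s') {v' : ι'}
    (hv' : v' ∈ s') : (s'.filter (v' ≤ ·)).image τ = (s'.image τ).filter (τ v' ≤ ·) := by
  ext b
  simp only [Finset.mem_image, Finset.mem_filter]
  constructor
  · rintro ⟨a, ⟨ha, hva⟩, rfl⟩
    exact ⟨⟨a, ha, rfl⟩, hτ hva⟩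
  · rintro ⟨⟨a, ha, rfl⟩, hle⟩
    refine ⟨a, ⟨ha, ?_⟩, rfl⟩
    by_contra hlt
    have hav : τ a ≤ τ v' := hτ (le_of_lt (not_le.1 hlt))
    have : τ a = τ v' := le_antisymm hav hle
    exact (not_le.1 hlt).ne (hinj ha hv' this)

/-- If a monotone map is NOT injective on `s'`, then for every cut vertex `v' ∈ s'` it fails to be injective on the
lower cut `s'_{≤v'}` or on the upper cut `s'_{≥v'}` (a colliding pair `a < b` has `τ` constant on `[a, b] ∩ s'`, which
meets one of the two cuts in two points). [cite: StacksProject, Tag 01FG] -/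
theorem not_injOn_cuts_of_not_injOn (hτ : Monotone τ) {s' : Finset ι'} (h : ¬ Set.InjOn τ ↑s') {v' : ι'}
    (hv' : v' ∈ s') :
    ¬ Set.InjOn τ ↑(s'.filter (· ≤ v')) ∨ ¬ Set.InjOn τ ↑(s'.filter (v' ≤ ·)) := by
  simp only [Set.InjOn, not_forall, exists_prop, Finset.mem_coe] at h
  obtain ⟨a, ha, b, hb, hab, hne⟩ := h
  -- order the colliding pair
  wlog hlt : a < b generalizing a b
  · exact this b hb a ha hab.symm (Ne.symm hne) (lt_of_le_of_ne (not_lt.1 hlt) (Ne.symm hne))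
  by_cases hbv : b ≤ v'
  · -- both `a < b ≤ v'` lie in the lower cut
    left
    intro hinj
    exact hne (hinj (by simp [ha, (le_of_lt hlt).trans hbv]) (by simp [hb, hbv]) hab)
  · by_cases hva : v' ≤ a
    · -- both `v' ≤ a < b` lie in the upper cut
      right
      intro hinj
      exact hne (hinj (by simp [ha, hva]) (by simp [hb, hva.trans (le_of_lt hlt)]) hab)
    · -- `a < v' < b`: `τ` is constant on `[a, b]`, so `τ a = τ v'` inside the lower cut
      left
      intro hinj
      have hav : a ≤ v' := le_of_lt (not_le.1 hva)
      have hvb : v' ≤ b := le_of_lt (not_le.1 hbv)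
      have h1 : τ a ≤ τ v' := hτ hav
      have h2 : τ v' ≤ τ b := hτ hvb
      have heq : τ a = τ v' := le_antisymm h1 (hab ▸ h2)
      exact (ne_of_lt (not_le.1 hva)) (hinj (by simp [ha, hav]) (by simp [hv']) heq)

end MonotoneCuts

/-! ### Refinement along a monotone map: the unsigned formula and its extension by zero -/

section Refine

variable {A : Type u} [CommRing A] {M : Finset ι ⥤ ModuleCat.{v} A} {M' : Finset ι' ⥤ ModuleCat.{v} A}
  (τ : ι' → ι) (φ : imageFunctor τ ⋙ M ⟶ M')

/-- The image of the sorted enumeration of `s'` under `τ` is `τ(s')`. [cite: StacksProject, Tag 01FG] -/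
theorem image_comp_orderEmbOfFin' (s' : Finset ι') {c : ℕ} (h : s'.card = c) :
    Finset.univ.image (τ ∘ ⇑(s'.orderEmbOfFin h)) = s'.image τ := by
  rw [← Finset.image_image, Finset.image_orderEmbOfFin_univ]

/-- **Refinement along a MONOTONE map, unsigned**: on a simplex `σ'` on which `τ` is injective,
`refine g σ' = φ_{σ'} (g.ext0At τ(σ') τ(σ'))` (no sign: the sorted enumeration stays sorted); otherwise `0`.
[cite: StacksProject, Tag 01FG] -/
theorem refineCochain_apply_of_monotone (hτ : Monotone τ) {n : ℤ} (g : SysCochain M n) (σ' : Simplex ι' n) :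
    refineCochain τ φ n g σ' =
      if Set.InjOn τ ↑σ'.1 then (φ.app σ'.1).hom (g.ext0At (σ'.1.image τ) (σ'.1.image τ)) else 0 := by
  rw [refineCochain_apply]
  split_ifs with hinj
  · have hsm : StrictMono (τ ∘ ⇑(σ'.1.orderEmbOfFin rfl)) := by
      intro i j hij
      have hlt := (σ'.1.orderEmbOfFin rfl).strictMono hij
      refine lt_of_le_of_ne (hτ (le_of_lt hlt)) fun heq => ?_
      exact (ne_of_lt hlt) (hinj (Finset.orderEmbOfFin_mem _ _ _) (Finset.orderEmbOfFin_mem _ _ _) heq)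
    rw [SysCochain.altEvalAt_of_strictMono _ hsm, image_comp_orderEmbOfFin']
  · have hni : ¬ Function.Injective (τ ∘ ⇑(σ'.1.orderEmbOfFin rfl)) := by
      intro hi
      apply hinj
      intro a ha b hb hab
      obtain ⟨i, rfl⟩ : ∃ i, σ'.1.orderEmbOfFin rfl i = a := by
        have := Finset.range_orderEmbOfFin σ'.1 rfl
        have ha' : a ∈ Set.range ⇑(σ'.1.orderEmbOfFin rfl) := by rw [this]; exact ha
        exact ha'
      obtain ⟨j, rfl⟩ : ∃ j, σ'.1.orderEmbOfFin rfl j = b := by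
        have := Finset.range_orderEmbOfFin σ'.1 rfl
        have hb' : b ∈ Set.range ⇑(σ'.1.orderEmbOfFin rfl) := by rw [this]; exact hb
        exact hb'
      rw [hi hab]
    rw [SysCochain.altEvalAt_of_not_injective _ hni, map_zero]

/-- **Extension by zero of a monotone refinement**: for `s' ⊆ t'` with `τ` injective on `t'`,
`(refine g).ext0At s' t' = φ_{t'} (g.ext0At τ(s') τ(t'))`. [cite: StacksProject, Tag 01FG] -/
theorem ext0At_refineCochain_of_monotone (hτ : Monotone τ) {n : ℤ} (g : SysCochain M n) (s' t' : Finset ι')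
    (hst : s' ⊆ t') (hinj : Set.InjOn τ ↑t') :
    (refineCochain τ φ n g).ext0At s' t' = (φ.app t').hom (g.ext0At (s'.image τ) (t'.image τ)) := by
  have hinj' : Set.InjOn τ ↑s' := hinj.mono (Finset.coe_subset.2 hst)
  have hcard : (s'.image τ).card = s'.card := Finset.card_image_of_injOn hinj'
  by_cases hs : s'.Nonempty ∧ (s'.card : ℤ) = n + 1
  · rw [SysCochain.ext0At_val (refineCochain τ φ n g) ⟨s', hs⟩ t' hst]
    change (M'.map (homOfLE hst)).hom (refineCochain τ φ n g ⟨s', hs⟩) = _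
    rw [refineCochain_apply_of_monotone τ φ hτ, if_pos hinj']
    change ((φ.app s') ≫ M'.map (homOfLE hst)).hom _ = _
    rw [← φ.naturality (homOfLE hst)]
    change (φ.app t').hom ((M.map ((imageFunctor τ).map (homOfLE hst))).hom (g.ext0At (s'.image τ) (s'.image τ))) = _
    have hsub : s'.image τ ⊆ t'.image τ := Finset.image_subset_image hst
    have : (imageFunctor τ).map (homOfLE hst) = homOfLE hsub := rfl
    rw [this]
    exact congrArg (φ.app t').hom (SysCochain.map_ext0At g _ _ _ subset_rfl hsub)
  · -- `s'` is not an `n`-simplex: both sides vanish (`#τ(s') = #s'`)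
    have hl : (refineCochain τ φ n g).ext0At s' t' = 0 := by
      unfold SysCochain.ext0At
      rw [dif_neg (fun h => hs h.1)]
    have hr : g.ext0At (s'.image τ) (t'.image τ) = 0 := by
      unfold SysCochain.ext0At
      rw [dif_neg]
      rintro ⟨⟨hne, hc⟩, _⟩
      apply hs
      refine ⟨?_, ?_⟩
      · obtain ⟨b, hb⟩ := hne
        obtain ⟨a, ha, _⟩ := Finset.mem_image.1 hb
        exact ⟨a, ha⟩
      · rw [hcard] at hc; exact hc
    rw [hl, hr, map_zero]

/-- A monotone refinement vanishes on a simplex where `τ` is not injective. [cite: StacksProject, Tag 01FG] -/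
theorem ext0At_refineCochain_of_not_injOn (hτ : Monotone τ) {n : ℤ} (g : SysCochain M n) (s' t' : Finset ι')
    (hinj : ¬ Set.InjOn τ ↑s') : (refineCochain τ φ n g).ext0At s' t' = 0 := by
  by_cases hs : (s'.Nonempty ∧ (s'.card : ℤ) = n + 1) ∧ s' ⊆ t'
  · rw [SysCochain.ext0At_val (refineCochain τ φ n g) ⟨s', hs.1⟩ t' hs.2]
    change (M'.map (homOfLE hs.2)).hom (refineCochain τ φ n g ⟨s', hs.1⟩) = 0
    rw [refineCochain_apply_of_monotone τ φ hτ, if_neg hinj, map_zero]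
  · unfold SysCochain.ext0At
    rw [dif_neg hs]

end Refine

/-! ### Multiplicativity on cochains -/

section Cup

variable {A : Type u} [CommRing A] {M N P : Finset ι ⥤ ModuleCat.{v} A} {M' N' P' : Finset ι' ⥤ ModuleCat.{v} A}
  {β : ∀ s : Finset ι, M.obj s →ₗ[A] N.obj s →ₗ[A] P.obj s}
  {β' : ∀ s' : Finset ι', M'.obj s' →ₗ[A] N'.obj s' →ₗ[A] P'.obj s'}
  (τ : ι' → ι) (φM : imageFunctor τ ⋙ M ⟶ M') (φN : imageFunctor τ ⋙ N ⟶ N') (φP : imageFunctor τ ⋙ P ⟶ P')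

/-- **Refinement along a monotone map is multiplicative on cochains**: if the refinement data intertwine the
pairings (`φ_P(β(x,y)) = β'(φ_M x, φ_N y)` at every `s'`), then
`refine (f ∪_β g) = refine f ∪_{β'} refine g` for all cochains `f`, `g` and all degrees.
[cite: Godement1958, II §6.6] [cite: StacksProject, Tag 01FP] -/
theorem refineCochain_cup (hτ : Monotone τ)
    (hφ : ∀ (s' : Finset ι') (x : M.obj (s'.image τ)) (y : N.obj (s'.image τ)),
      (φP.app s').hom (β (s'.image τ) x y) = β' s' ((φM.app s').hom x) ((φN.app s').hom y))
    {p q n : ℤ} (f : SysCochain M p) (g : SysCochain N q) :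
    refineCochain τ φP n (cup β p q n f g) = cup β' p q n (refineCochain τ φM p f) (refineCochain τ φN q g) := by
  funext σ'
  rw [refineCochain_apply_of_monotone τ φP hτ, cup_apply]
  by_cases hinj : Set.InjOn τ ↑σ'.1
  · rw [if_pos hinj]
    -- the left-hand side: the cup product at `τ(σ')`, an `n`-simplex
    have hcard : (σ'.1.image τ).card = σ'.1.card := Finset.card_image_of_injOn hinj
    have hS : (σ'.1.image τ).Nonempty ∧ ((σ'.1.image τ).card : ℤ) = n + 1 :=
      ⟨σ'.2.1.image _, by rw [hcard]; exact σ'.2.2⟩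
    rw [show (cup β p q n f g).ext0At (σ'.1.image τ) (σ'.1.image τ) = cup β p q n f g ⟨_, hS⟩ from
        SysCochain.ext0At_self (cup β p q n f g) ⟨_, hS⟩, cup_apply, map_sum]
    change ∑ v ∈ σ'.1.image τ, _ = _
    rw [Finset.sum_image (fun a ha b hb h => hinj ha hb h)]
    refine Finset.sum_congr rfl fun v' hv' => ?_
    rw [hφ, ext0At_refineCochain_of_monotone τ φM hτ f _ _ (Finset.filter_subset _ _) hinj,
      ext0At_refineCochain_of_monotone τ φN hτ g _ _ (Finset.filter_subset _ _) hinj,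
      image_filter_le_of_monotone_injOn hτ hinj hv', image_filter_ge_of_monotone_injOn hτ hinj hv']
  · rw [if_neg hinj, eq_comm]
    refine Finset.sum_eq_zero fun v' hv' => ?_
    rcases not_injOn_cuts_of_not_injOn hτ hinj hv' with h | h
    · rw [ext0At_refineCochain_of_not_injOn τ φM hτ f _ _ h, map_zero, LinearMap.zero_apply]
    · rw [ext0At_refineCochain_of_not_injOn τ φN hτ g _ _ h, map_zero]

end Cup

end OrderedCech

end Literature.Algebra.Homology

end
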